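/-
Copyright (c) 2026 the pub-hodgecm-mathlib formalisation cell (harness21).  Prover seat hodgecm-mathlib-K2E3-p31 (g2) on LEAD F0P6-plan (g14) BATCH #164 (1) ∕
#170 (A), Track B «K2-LIT» ∕ hLiu418 #184♮ = `stmt-HodgeConjecture-24832`, F4 road (E), (E-d) pivot, input (R-grp) FILE (ii): THE FRAME CHASE FOR THE RIGHT LEG —
`scaleConj` against a GENERAL Kronecker product and the index chase `toUForm_𝕎 ((1 ⊗ k)_σ) = relabel E (toBig (1, toUForm_{V′} k_σ))` entry by entry (the right-leg
twin of ★ K2E5-p16 FILE 1 `K2LiuArchTensorPlaceSecMatrix.scaleConj_reindex_kronecker_one` + FILE 2a `K2LiuArchTensorFrameChase.reindex_signSplit_scaleConj_tensor`).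
Desk K2Liu-p27 (g2); consumer (R-grp) FILE (iii) `K2LiuArchPlaceSecJPartnerEmb`.  THEOREMS ONLY (no `def`, no `instance`, no notation, no `sorry`).
-/
import Summits.HodgeConjecture.HodgeConjecture.Theorems.K2LiuArchTensorFrameChase    -- ★ K2E5-p16 FILE 2a (left leg; `signSplit_apply_of_pos ∕ _of_not_pos`, FILE 1)
import Summits.HodgeConjecture.HodgeConjecture.Theorems.K2LiuArchTensorPlaceSec      -- ★ K2E5-p16 FILE 2b-2 (`scaleConj_one'`)
import HarnessLib

/-!
# Crux `HLiu418`, F4 (E-d) pivot, (R-grp) FILE (ii): the frame chase for `1 ⊗ₖ K` (and for a general `A ⊗ₖ B`)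

Cell `hodgecm-mathlib`, crux item hLiu418 = `stmt-HodgeConjecture-24832` (helper lane `--supports`, count-neutral; closes no socket).

Matrix currencies as in ★ FILE 2a: ★ `coe_toUForm` (`toUForm ε D … k = reindex ε ε (scaleConj D k)`), ★ `coe_toBig` (`toBig (g_V, g_W) = reindex dpEquiv dpEquiv
(g_V ⊗ₖ g_W)`), ★ `coe_partnerEmb` (`partnerEmb k = reindex epsD epsD (1 ⊗ₖ k)`), `scaleConj D K i j = D_i K_{ij} D_j⁻¹`.
* §1 **`scaleConj_reindex_kronecker`** — THE GENERAL FORM: for scalings `D_{e(a,b)} = D¹_a · D²_b` (no non-vanishing needed),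
  `scaleConj D (reindex e e (A ⊗ₖ B)) = reindex e e (scaleConj D¹ A ⊗ₖ scaleConj D² B)`; both legs are corollaries: ★ FILE 1's `A ⊗ₖ 1` (`scaleConj D² 1 = 1`
  for `D² ≠ 0`) and **`scaleConj_reindex_one_kronecker`** — `scaleConj D (reindex e e (1 ⊗ₖ K)) = reindex e e (1 ⊗ₖ scaleConj D² K)` (`D¹ ≠ 0`).
* §2 **`reindex_signSplit_scaleConj_one_tensor`** — THE RIGHT-LEG INDEX CHASE: for any frame identification `E : DPIdx (PosIdx x) (NegIdx x) (PosIdx y) (NegIdx y) ≃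
  PosIdx z ⊕ NegIdx z` COMPATIBLE with the sign splittings through `dpEquiv` (★ FILE 2a's `hE` shape; ★ `sumCongr_tensorEquiv_compatible`: ★ J0's is),
  `reindex (signSplit z) (signSplit z) (scaleConj D (reindex e e (1 ⊗ₖ K))) = reindex E E (reindex dpEquiv dpEquiv (1 ⊗ₖ reindex (signSplit y) (signSplit y) (scaleConj D² K)))`
  — i.e. `toUForm_𝕎 ((1 ⊗ k)_σ) = relabel E (toBig (1, toUForm_{V′} k_σ))` entry by entry (`toBig (1, g_W) = reindex dpEquiv (1 ⊗ₖ g_W)`, ★ `coe_toBig`).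
FILE (iii) wraps §2 with ★ FILE (i) `coe_archAt_archPart_partnerEmb` and the `V′`-side place section into (R-grp).
References: [KonnoKonno2007] §3.1 (3.1); [Kudla1994] §2; [MoeglinVignerasWaldspurger1987] Ch. 1 I.17; [HarrisKudlaSweet1996] §1 (1.8).
HONEST LABEL: HC_CM is proved only modulo the 7 printed citations (2 remaining named inputs: hLiu418 = stmt-HodgeConjecture-24832,
h413 = stmt-HodgeConjecture-24833) until rung 0 closes; count-neutral helper, closes no socket.
-/

set_option autoImplicit false
set_option linter.dupNamespace false -- the mandated namespace repeats `HodgeConjecture.HodgeConjecture`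

noncomputable section

open Matrix
open scoped Kronecker

namespace Summit.HodgeConjecture.HodgeConjecture.Cruxes.HLiu418.K2LiuArchTensorFrameChaseRight

open Literature.NumberTheory.Weil1964 (PosIdx NegIdx signSplit scaleConj scaleConj_apply)
open Literature.RepresentationTheory.HeisenbergGroup Literature.Analysis.SegalBargmann
open Literature.RepresentationTheory.KonnoKonno2007 Literature.RepresentationTheory.KonnoKonno2007.RealDualPair
open K2LiuArchTensorFrameChase (signSplit_apply_of_pos signSplit_apply_of_not_pos signSplit_symm_apply)

variable {N M n : ℕ}

/-! ## §1 `scaleConj` against a Kronecker product -/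

/-- **SCALED CONJUGATION IS MULTIPLICATIVE ON KRONECKER PRODUCTS**: for scalings `D_{e(a,b)} = D¹_a · D²_b`,
`scaleConj D (reindex e e (A ⊗ₖ B)) = reindex e e (scaleConj D¹ A ⊗ₖ scaleConj D² B)` (`(D¹_a D²_b) (A_{aa′} B_{bb′}) (D¹_{a′} D²_{b′})⁻¹ =
(D¹_a A_{aa′} D¹_{a′}⁻¹)(D²_b B_{bb′} D²_{b′}⁻¹)`). [folklore] -/
theorem scaleConj_reindex_kronecker (D₁ : Fin N → ℝ) (D₂ : Fin M → ℝ) (e : Fin N × Fin M ≃ Fin n)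
    (D : Fin n → ℝ) (hD : ∀ k, D k = D₁ (e.symm k).1 * D₂ (e.symm k).2) (A : Matrix (Fin N) (Fin N) ℂ) (B : Matrix (Fin M) (Fin M) ℂ) :
    scaleConj D (Matrix.reindex e e (A ⊗ₖ B)) = Matrix.reindex e e (scaleConj D₁ A ⊗ₖ scaleConj D₂ B) := by
  ext k k'
  rw [scaleConj_apply, Matrix.reindex_apply, Matrix.submatrix_apply, Matrix.kroneckerMap_apply, Matrix.reindex_apply, Matrix.submatrix_apply,
    Matrix.kroneckerMap_apply, scaleConj_apply, scaleConj_apply, hD k, hD k']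
  push_cast
  rw [mul_inv]
  ring

/-- **THE RIGHT LEG**: for `D_{e(a,b)} = D¹_a · D²_b` with `D¹ ≠ 0`, `scaleConj D (reindex e e (1 ⊗ₖ K)) = reindex e e (1 ⊗ₖ scaleConj D² K)` (§1 and
`scaleConj D¹ 1 = 1`, ★ `K2LiuArchTensorPlaceSec.scaleConj_one'`; the twin of ★ FILE 1 `scaleConj_reindex_kronecker_one`). [folklore] -/
theorem scaleConj_reindex_one_kronecker (D₁ : Fin N → ℝ) (hD₁ : ∀ i, D₁ i ≠ 0) (D₂ : Fin M → ℝ) (e : Fin N × Fin M ≃ Fin n)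
    (D : Fin n → ℝ) (hD : ∀ k, D k = D₁ (e.symm k).1 * D₂ (e.symm k).2) (K : Matrix (Fin M) (Fin M) ℂ) :
    scaleConj D (Matrix.reindex e e ((1 : Matrix (Fin N) (Fin N) ℂ) ⊗ₖ K)) =
      Matrix.reindex e e ((1 : Matrix (Fin N) (Fin N) ℂ) ⊗ₖ scaleConj D₂ K) := by
  rw [scaleConj_reindex_kronecker D₁ D₂ e D hD, K2LiuArchTensorPlaceSec.scaleConj_one' hD₁]

/-! ## §2 The right-leg index chase against a compatible frame identification -/

/-- **THE FRAME CHASE FOR THE RIGHT LEG** (`toUForm_𝕎 ((1 ⊗ k)_σ) = relabel E (toBig (1, toUForm_{V′} k_σ))` entry by entry): for ANY identification `E`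
compatible with the sign splittings through `dpEquiv` and scalings `D_{e(a,b)} = D¹_a · D²_b` (`D¹ ≠ 0`),
`reindex (signSplit z) (signSplit z) (scaleConj D (reindex e e (1 ⊗ₖ K)))
   = reindex E E (reindex dpEquiv dpEquiv (1 ⊗ₖ (reindex (signSplit y) (signSplit y) (scaleConj D² K))))`
(the twin of ★ FILE 2a `reindex_signSplit_scaleConj_tensor`, same `hE`). [cite: KonnoKonno2007, §3.1 (3.1); Kudla1994, §2] [cite: MoeglinVignerasWaldspurger1987, Ch. 1 I.17] -/
theorem reindex_signSplit_scaleConj_one_tensor (x : Fin N → ℝ) (y : Fin M → ℝ) (e : Fin N × Fin M ≃ Fin n) (z : Fin n → ℝ)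
    (D₁ : Fin N → ℝ) (hD₁ : ∀ i, D₁ i ≠ 0) (D₂ : Fin M → ℝ) (D : Fin n → ℝ) (hD : ∀ k, D k = D₁ (e.symm k).1 * D₂ (e.symm k).2)
    (K : Matrix (Fin M) (Fin M) ℂ) (E : DPIdx (PosIdx x) (NegIdx x) (PosIdx y) (NegIdx y) ≃ PosIdx z ⊕ NegIdx z)
    (hE : ∀ i, (dpEquiv (PosIdx x) (NegIdx x) (PosIdx y) (NegIdx y)).symm (E.symm i) =
      (signSplit x (e.symm ((signSplit z).symm i)).1, signSplit y (e.symm ((signSplit z).symm i)).2)) :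
    Matrix.reindex (signSplit z) (signSplit z) (scaleConj D (Matrix.reindex e e ((1 : Matrix (Fin N) (Fin N) ℂ) ⊗ₖ K))) =
      Matrix.reindex E E (Matrix.reindex (dpEquiv (PosIdx x) (NegIdx x) (PosIdx y) (NegIdx y)) (dpEquiv (PosIdx x) (NegIdx x) (PosIdx y) (NegIdx y))
        ((1 : Matrix (PosIdx x ⊕ NegIdx x) (PosIdx x ⊕ NegIdx x) ℂ) ⊗ₖ Matrix.reindex (signSplit y) (signSplit y) (scaleConj D₂ K))) := by
  rw [scaleConj_reindex_one_kronecker D₁ hD₁ D₂ e D hD K]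
  ext i j
  rw [Matrix.reindex_apply, Matrix.submatrix_apply, Matrix.reindex_apply, Matrix.submatrix_apply, Matrix.kroneckerMap_apply,
    Matrix.reindex_apply, Matrix.submatrix_apply, Matrix.reindex_apply, Matrix.submatrix_apply, hE i, hE j, Matrix.kroneckerMap_apply,
    Matrix.reindex_apply, Matrix.submatrix_apply, Equiv.symm_apply_apply, Equiv.symm_apply_apply,
    Matrix.one_apply, Matrix.one_apply]
  by_cases ha : (e.symm ((signSplit z).symm i)).1 = (e.symm ((signSplit z).symm j)).1
  · rw [if_pos ha, if_pos (congrArg (signSplit x) ha)]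
  · rw [if_neg ha, if_neg (fun h => ha ((signSplit x).injective h))]

end Summit.HodgeConjecture.HodgeConjecture.Cruxes.HLiu418.K2LiuArchTensorFrameChaseRight

end
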